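import Summits.NavierStokesRegularity.NavierStokesRegularity.Theorems.ExtremiserTransienceTwoThirdsGaugeL2
import Summits.NavierStokesRegularity.NavierStokesRegularity.Theorems.ExtremiserTransienceTwoThirdsGaugePointwise
import Summits.NavierStokesRegularity.NavierStokesRegularity.Theorems.ExtremiserTransienceTwoThirdsRemainderCurlFree
import Summits.NavierStokesRegularity.NavierStokesRegularity.Theorems.ExtremiserTransienceTwoThirdsDefs
import HarnessLib

/-!
# Route `ExtremiserTransience`, crux `NearExtremalTransiencePerFlow` (stmt-NavierStokesRegularity-26567), LINE g10-1 «two_thirds»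
# (ns-idea-10 g10), stub S2 `FirstOrderIdentity`: the TRUNCATED BIOT–SAVART GAUGE of the limit field — `L²` facts

Helper file for S2 (`--supports stmt-NavierStokesRegularity-26567`), sequel of `…TwoThirdsGaugePointwise` and `…TwoThirdsGaugeL2`.
For `ψ = K ∗ h`, `h = ζV`, `ζ = ballCutoff c R`, `V` smooth divergence free with `‖V‖ ≤ 1` and linear growth `A_E`:

* `integral_norm_sq_truncation_le` — `∫‖h‖² ≤ 4A_E R`;
* `integral_norm_sq_curl_truncation_le`, `integral_sq_div_truncation_le` — `∫‖curl h‖² ≤ 2Z_{B(c,4R)} + 8c²C₀²A_E/R`,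
  `∫(div h)² ≤ 4C₀²A_E/R` (`c = ‖curlCLM‖`, `‖Dζ‖ ≤ C₀/R`);
* `setIntegral_norm_sq_fderiv_le_truncation` — `∫_{B(c,2R)} ‖DV‖² ≤ ∫ ‖Dh‖²` (`h = V` on `B(c,2R)`);
* `gauge_L2` — one universal constant `C` with `∫‖Dψ‖² ≤ C·A_E·R`, `∫‖Dh‖² ≤ C·(Z_{B(c,4R)} + C₀²A_E/R)`,
  `∫‖D²ψ‖² ≤ C·∫‖Dh‖²` (Calderón–Zygmund at `p = 2` and the `L²` div–curl estimate of `…TwoThirdsGaugeL2`).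

HONEST FRAMING: potential theory on `ℝ³`; nothing about Navier–Stokes regularity or blow-up is proved; S2, the crux ⟨26567⟩ and NS
regularity are OPEN; no summit is proved by a line. [folklore]
-/

noncomputable section

open scoped Topology InnerProductSpace RealInnerProductSpace ENNReal ContDiff
open MeasureTheory Filter Set Metric
open Literature.Analysis.FluidPDE
open Summit.NavierStokesRegularity.NavierStokesRegularity.Theorems.DepletionLadder.KStar.HalfSpace
open Summit.NavierStokesRegularity.NavierStokesRegularity.Theorems.NearExtremalTransiencePerFlow.LocalMaximiser

namespace Summit.NavierStokesRegularity.NavierStokesRegularity.Theorems.NearExtremalTransiencePerFlow.TwoThirds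

-- the summit's namespace repeats the problem name by convention (D-0017)
set_option linter.dupNamespace false

variable {V : E3 → E3} {A_E : ℝ} {c : E3} {R : ℝ}

/-- The integral of a nonnegative continuous density vanishing off `B(c,r)` and dominated there by another continuous density is at
most the ball integral of the latter. [folklore] -/
theorem integral_le_setIntegral_ball_of_support {f g : E3 → ℝ} (hf : Continuous f) (hg : Continuous g) {r : ℝ}
    (hsupp : ∀ y, f y ≠ 0 → y ∈ ball c r) (hle : ∀ y, f y ≤ g y) :
    Integrable f ∧ ∫ y, f y ≤ ∫ y in ball c r, g y := by
  have e : f = (ball c r).indicator f := by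
    funext y
    by_cases hy : y ∈ ball c r
    · rw [indicator_of_mem hy]
    · rw [indicator_of_notMem hy]
      by_contra h
      exact hy (hsupp y h)
  have hfi : IntegrableOn f (ball c r) :=
    (hf.continuousOn.integrableOn_compact (isCompact_closedBall c r)).mono_set ball_subset_closedBall
  have hgi : IntegrableOn g (ball c r) :=
    (hg.continuousOn.integrableOn_compact (isCompact_closedBall c r)).mono_set ball_subset_closedBall
  refine ⟨by rw [e]; exact hfi.integrable_indicator measurableSet_ball, ?_⟩
  rw [e, integral_indicator measurableSet_ball]
  exact setIntegral_mono hfi hgi hle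

/-- `∫ ‖h‖² ≤ 4A_E R` for the truncation `h = ζV` (support in `B(c,4R)`, `‖h‖ ≤ ‖V‖`, linear growth). [folklore] -/
theorem integral_norm_sq_truncation_le (hVs : ContDiff ℝ (⊤ : ℕ∞) V) (hdiv : VectorCalculus.IsDivFree V) (hV1 : ∀ x, ‖V x‖ ≤ 1)
    (hgr : HasLinearGrowth A_E V) (hR : 0 < R) {C₀ : ℝ} (hC₀ : ∀ y, ‖fderiv ℝ (ballCutoff c R) y‖ ≤ C₀ / R) :
    Integrable (fun y => ‖ballCutoff c R y • V y‖ ^ 2) ∧ ∫ y, ‖ballCutoff c R y • V y‖ ^ 2 ≤ 4 * A_E * R := by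
  obtain ⟨hh, -, -, hhV, -, hhsupp, -⟩ := truncation_facts (c := c) hVs hdiv hV1 hR hC₀
  have h := integral_le_setIntegral_ball_of_support (c := c) (r := 4 * R) (f := fun y => ‖ballCutoff c R y • V y‖ ^ 2)
    (g := fun y => ‖V y‖ ^ 2) (hh.continuous.norm.pow 2) (hVs.continuous.norm.pow 2)
    (fun y hy => by
      have h3 := hhsupp y (by intro h0; exact hy (by simp only [h0, norm_zero]; norm_num))
      rw [mem_ball, dist_eq_norm]; linarith)
    (fun y => pow_le_pow_left₀ (norm_nonneg _) (hhV y) 2)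
  refine ⟨h.1, h.2.trans ?_⟩
  have := hgr c (4 * R) (by positivity)
  linarith

/-- `∫ ‖curl h‖² ≤ 2Z_{B(c,4R)} + 8‖curlCLM‖²C₀²A_E/R` for the truncation (`curl(ζV) = ζω + curlCLM(Dζ ⊗ V)`). [folklore] -/
theorem integral_norm_sq_curl_truncation_le (hVs : ContDiff ℝ (⊤ : ℕ∞) V) (hdiv : VectorCalculus.IsDivFree V) (hV1 : ∀ x, ‖V x‖ ≤ 1)
    (hgr : HasLinearGrowth A_E V) (hR : 0 < R) {C₀ : ℝ} (hC₀ : ∀ y, ‖fderiv ℝ (ballCutoff c R) y‖ ≤ C₀ / R) :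
    Integrable (fun y => ‖curl (fun y => ballCutoff c R y • V y) y‖ ^ 2) ∧
    ∫ y, ‖curl (fun y => ballCutoff c R y • V y) y‖ ^ 2 ≤ 2 * Zb V c (4 * R) + 8 * ‖curlCLM‖ ^ 2 * C₀ ^ 2 * A_E / R := by
  obtain ⟨hh, hhc, -, -, -, hhsupp, -, -, -, hgle, hgsupp⟩ := truncation_facts (c := c) hVs hdiv hV1 hR hC₀
  set ζ := ballCutoff c R with hζ
  have hζd : Differentiable ℝ ζ := (contDiff_ballCutoff c R (n := ⊤)).differentiable (by simp)
  have hVd : Differentiable ℝ V := hVs.differentiable (by simp)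
  have h01 : ∀ y, 0 ≤ ζ y ∧ ζ y ≤ 1 := fun y => ⟨ballCutoff_nonneg c R y, ballCutoff_le_one c R y⟩
  set cc := ‖curlCLM‖ with hcc
  -- the dominating density
  set g : E3 → ℝ := fun y => 2 * zd V y + 2 * (cc ^ 2 * (C₀ / R) ^ 2 * ‖V y‖ ^ 2) with hg
  have hgcont : Continuous g :=
    (continuous_const.mul (continuous_zd' hVs)).add (continuous_const.mul (continuous_const.mul (hVs.continuous.norm.pow 2)))
  have hcurl_eq : ∀ y, curl (fun y => ζ y • V y) y = ζ y • curl V y + curlCLM ((fderiv ℝ ζ y).smulRight (V y)) := fun y =>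
    curl_smul (hζd y) (hVd y)
  have hpt : ∀ y, ‖curl (fun y => ζ y • V y) y‖ ^ 2 ≤ g y := by
    intro y
    rw [hcurl_eq y]
    have h1 : ‖ζ y • curl V y‖ ≤ ‖curl V y‖ := by
      rw [norm_smul, Real.norm_eq_abs, abs_of_nonneg (h01 y).1]
      exact mul_le_of_le_one_left (norm_nonneg _) (h01 y).2
    have h2 : ‖curlCLM ((fderiv ℝ ζ y).smulRight (V y))‖ ≤ cc * (C₀ / R) * ‖V y‖ :=
      (norm_rankOneCurl_le ζ V y).trans (mul_le_mul_of_nonneg_right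
        (mul_le_mul_of_nonneg_left (hC₀ y) (norm_nonneg curlCLM)) (norm_nonneg _))
    have h3 := norm_add_le (ζ y • curl V y) (curlCLM ((fderiv ℝ ζ y).smulRight (V y)))
    have h0 : 0 ≤ ‖ζ y • curl V y + curlCLM ((fderiv ℝ ζ y).smulRight (V y))‖ := norm_nonneg _
    have hzd : zd V y = ‖curl V y‖ ^ 2 := rfl
    rw [hg]; dsimp only; rw [hzd]
    have hN2 := pow_le_pow_left₀ h0 h3 2
    have hA2 := pow_le_pow_left₀ (norm_nonneg _) h1 2
    have hB2 := pow_le_pow_left₀ (norm_nonneg _) h2 2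
    have hAB := two_mul_le_add_sq ‖ζ y • curl V y‖ ‖curlCLM ((fderiv ℝ ζ y).smulRight (V y))‖
    linarith [hN2, hA2, hB2, hAB]
  -- support: off `B(c,4R)` the truncation vanishes near `y`, so its curl vanishes at `y`
  have hsupp : ∀ y, ‖curl (fun y => ζ y • V y) y‖ ^ 2 ≠ 0 → y ∈ ball c (4 * R) := by
    intro y hy
    by_contra hout
    rw [mem_ball, dist_eq_norm, not_lt] at hout
    have hy3 : y ∉ closedBall c (3 * R) := by
      rw [mem_closedBall, dist_eq_norm, not_le]; linarith
    have hev : (fun y => ζ y • V y) =ᶠ[𝓝 y] fun _ => (0 : E3) := by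
      filter_upwards [ballCutoff_eventuallyEq_zero hR hy3] with z hz
      rw [show ζ z = 0 from hz, zero_smul]
    have h0 : curl (fun y => ζ y • V y) y = 0 := by
      have e : curl (fun y => ζ y • V y) y = curl (fun _ => (0 : E3)) y := by simp only [curl, hev.fderiv_eq]
      rw [e, curl_fun_zero]
    exact hy (by rw [h0, norm_zero, zero_pow two_ne_zero])
  have hmain := integral_le_setIntegral_ball_of_support (c := c) (r := 4 * R)
    (f := fun y => ‖curl (fun y => ζ y • V y) y‖ ^ 2) (g := g)
    ((continuous_curl (hh.of_le (by norm_cast))).norm.pow 2) hgcont hsupp hpt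
  refine ⟨hmain.1, hmain.2.trans ?_⟩
  -- `∫_{B(c,4R)} g = 2 Z_{B(c,4R)} + 2c²(C₀/R)² ∫_{B(c,4R)} ‖V‖²`
  have izd : IntegrableOn (zd V) (ball c (4 * R)) :=
    ((continuous_zd' hVs).continuousOn.integrableOn_compact (isCompact_closedBall c _)).mono_set ball_subset_closedBall
  have iV : IntegrableOn (fun y => ‖V y‖ ^ 2) (ball c (4 * R)) :=
    ((hVs.continuous.norm.pow 2).continuousOn.integrableOn_compact (isCompact_closedBall c _)).mono_set ball_subset_closedBall
  have e : ∫ y in ball c (4 * R), g y = 2 * Zb V c (4 * R) + 2 * (cc ^ 2 * (C₀ / R) ^ 2) * ∫ y in ball c (4 * R), ‖V y‖ ^ 2 := by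
    simp only [hg]
    rw [integral_add (izd.const_mul 2) ((iV.const_mul _).const_mul 2), integral_const_mul, integral_const_mul,
      integral_const_mul]
    simp only [Zb]
    ring
  rw [e]
  have hE := hgr c (4 * R) (by positivity)
  have hcoef : 0 ≤ 2 * (cc ^ 2 * (C₀ / R) ^ 2) := by positivity
  calc 2 * Zb V c (4 * R) + 2 * (cc ^ 2 * (C₀ / R) ^ 2) * ∫ y in ball c (4 * R), ‖V y‖ ^ 2
      ≤ 2 * Zb V c (4 * R) + 2 * (cc ^ 2 * (C₀ / R) ^ 2) * (A_E * (4 * R)) := by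
        gcongr
    _ = 2 * Zb V c (4 * R) + 8 * cc ^ 2 * C₀ ^ 2 * A_E / R := by
        field_simp
        ring

/-- `∫ (div h)² ≤ 4C₀²A_E/R` for the truncation (`div(ζV) = Dζ(V)`). [folklore] -/
theorem integral_sq_div_truncation_le (hVs : ContDiff ℝ (⊤ : ℕ∞) V) (hdiv : VectorCalculus.IsDivFree V) (hV1 : ∀ x, ‖V x‖ ≤ 1)
    (hgr : HasLinearGrowth A_E V) (hR : 0 < R) {C₀ : ℝ} (hC₀ : ∀ y, ‖fderiv ℝ (ballCutoff c R) y‖ ≤ C₀ / R) :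
    Integrable (fun y => (VectorCalculus.divergence (fun y => ballCutoff c R y • V y) y) ^ 2) ∧
    ∫ y, (VectorCalculus.divergence (fun y => ballCutoff c R y • V y) y) ^ 2 ≤ 4 * C₀ ^ 2 * A_E / R := by
  obtain ⟨-, -, -, -, -, -, hdivh, hgs, -, hgle, hgsupp⟩ := truncation_facts (c := c) hVs hdiv hV1 hR hC₀
  rw [hdivh]
  set g : E3 → ℝ := fun y => fderiv ℝ (ballCutoff c R) y (V y) with hg
  have hmain := integral_le_setIntegral_ball_of_support (c := c) (r := 4 * R) (f := fun y => g y ^ 2)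
    (g := fun y => (C₀ / R) ^ 2 * ‖V y‖ ^ 2) (hgs.continuous.pow 2) (continuous_const.mul (hVs.continuous.norm.pow 2))
    (fun y hy => by
      have h3 := (hgsupp y (by intro h0; exact hy (by simp [show g y = 0 from h0]))).2
      rw [mem_ball, dist_eq_norm]; linarith)
    (fun y => by
      have h1 := hgle y
      calc g y ^ 2 = |g y| ^ 2 := (sq_abs _).symm
        _ ≤ (C₀ / R * ‖V y‖) ^ 2 := pow_le_pow_left₀ (abs_nonneg _) h1 2
        _ = (C₀ / R) ^ 2 * ‖V y‖ ^ 2 := by ring)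
  refine ⟨hmain.1, hmain.2.trans ?_⟩
  rw [integral_const_mul]
  have hE := hgr c (4 * R) (by positivity)
  calc (C₀ / R) ^ 2 * ∫ y in ball c (4 * R), ‖V y‖ ^ 2 ≤ (C₀ / R) ^ 2 * (A_E * (4 * R)) :=
        mul_le_mul_of_nonneg_left hE (by positivity)
    _ = 4 * C₀ ^ 2 * A_E / R := by field_simp

/-- `∫_{B(c,2R)} ‖DV‖² ≤ ∫ ‖Dh‖²`: the truncation agrees with `V` on the open ball `B(c,2R)`. [folklore] -/
theorem setIntegral_norm_sq_fderiv_le_truncation (hVs : ContDiff ℝ (⊤ : ℕ∞) V) (hdiv : VectorCalculus.IsDivFree V)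
    (hV1 : ∀ x, ‖V x‖ ≤ 1) (hR : 0 < R) {C₀ : ℝ} (hC₀ : ∀ y, ‖fderiv ℝ (ballCutoff c R) y‖ ≤ C₀ / R) :
    Integrable (fun y => ‖fderiv ℝ (fun y => ballCutoff c R y • V y) y‖ ^ 2) ∧
    ∫ y in ball c (2 * R), ‖fderiv ℝ V y‖ ^ 2 ≤ ∫ y, ‖fderiv ℝ (fun y => ballCutoff c R y • V y) y‖ ^ 2 := by
  obtain ⟨hh, hhc, -, -, hheq, -⟩ := truncation_facts (c := c) hVs hdiv hV1 hR hC₀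
  have hcont : Continuous fun y => ‖fderiv ℝ (fun y => ballCutoff c R y • V y) y‖ ^ 2 :=
    ((hh.continuous_fderiv (by simp)).norm).pow 2
  have hsuppD : HasCompactSupport fun y => ‖fderiv ℝ (fun y => ballCutoff c R y • V y) y‖ ^ 2 := by
    refine (hhc.fderiv (𝕜 := ℝ)).mono fun y hy => ?_
    rw [Function.mem_support] at hy ⊢
    intro h0
    exact hy (by rw [h0, norm_zero, zero_pow two_ne_zero])
  have hint : Integrable fun y => ‖fderiv ℝ (fun y => ballCutoff c R y • V y) y‖ ^ 2 :=
    hcont.integrable_of_hasCompactSupport hsuppD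
  refine ⟨hint, ?_⟩
  have e : ∫ y in ball c (2 * R), ‖fderiv ℝ V y‖ ^ 2 = ∫ y in ball c (2 * R), ‖fderiv ℝ (fun y => ballCutoff c R y • V y) y‖ ^ 2 := by
    refine setIntegral_congr_fun measurableSet_ball fun y hy => ?_
    show ‖fderiv ℝ V y‖ ^ 2 = ‖fderiv ℝ (fun y => ballCutoff c R y • V y) y‖ ^ 2
    rw [(hheq y hy).fderiv_eq]
  rw [e]
  exact setIntegral_le_integral hint (Eventually.of_forall fun y => by positivity)

/-- **THE GAUGE PACKAGE, `L²` half.**  One universal constant `C` such that for every smooth divergence-free `V` with `‖V‖ ≤ 1`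
and linear growth `A_E ≥ 0`, every centre `c`, radius `R > 0` and cutoff-gradient constant `C₀` (`‖D(ballCutoff c R)‖ ≤ C₀/R`):
`∫‖Dψ‖² ≤ C·A_E·R`, `∫‖Dh‖² ≤ C(Z_{B(c,4R)} + C₀²A_E/R)` and `∫‖D²ψ‖² ≤ C·∫‖Dh‖²` (`h = ζV`, `ψ = K ∗ h`). [folklore] -/
theorem gauge_L2 : ∃ C : ℝ, 0 ≤ C ∧ ∀ (V : E3 → E3) (A_E : ℝ) (c : E3) (R C₀ : ℝ),
    ContDiff ℝ (⊤ : ℕ∞) V → VectorCalculus.IsDivFree V → (∀ x, ‖V x‖ ≤ 1) → HasLinearGrowth A_E V → 0 ≤ A_E → 0 < R →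
    0 ≤ C₀ → (∀ y, ‖fderiv ℝ (ballCutoff c R) y‖ ≤ C₀ / R) →
      Integrable (fun x => ‖fderiv ℝ (biotSavart fun y => ballCutoff c R y • V y) x‖ ^ 2) ∧
      (∫ x, ‖fderiv ℝ (biotSavart fun y => ballCutoff c R y • V y) x‖ ^ 2 ≤ C * A_E * R) ∧
      Integrable (fun y => ‖fderiv ℝ (fun y => ballCutoff c R y • V y) y‖ ^ 2) ∧
      (∫ y, ‖fderiv ℝ (fun y => ballCutoff c R y • V y) y‖ ^ 2 ≤ C * (Zb V c (4 * R) + C₀ ^ 2 * A_E / R)) ∧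
      Integrable (fun x => ‖iteratedFDeriv ℝ 2 (biotSavart fun y => ballCutoff c R y • V y) x‖ ^ 2) ∧
      (∫ x, ‖iteratedFDeriv ℝ 2 (biotSavart fun y => ballCutoff c R y • V y) x‖ ^ 2 ≤
        C * ∫ y, ‖fderiv ℝ (fun y => ballCutoff c R y • V y) y‖ ^ 2) := by
  obtain ⟨C₁, hC₁0, hC₁⟩ := exists_integral_norm_sq_fderiv_biotSavart_le
  obtain ⟨C₂, hC₂0, hC₂⟩ := exists_integral_norm_sq_iteratedFDeriv_two_biotSavart_le
  obtain ⟨C₃, hC₃0, hC₃⟩ := exists_integral_norm_sq_fderiv_le_curl_add_div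
  set cc := ‖curlCLM‖ with hcc
  refine ⟨max (4 * C₁) (max C₂ (C₃ * (2 + 8 * cc ^ 2 + 4))), le_max_of_le_left (by positivity), ?_⟩
  intro V A_E c R C₀ hVs hdiv hV1 hgr hAE hR hC₀0 hC₀
  obtain ⟨hh, hhc, -⟩ := truncation_facts (c := c) hVs hdiv hV1 hR hC₀
  obtain ⟨ih, hih⟩ := integral_norm_sq_truncation_le (c := c) hVs hdiv hV1 hgr hR hC₀
  obtain ⟨icurl, hcurl⟩ := integral_norm_sq_curl_truncation_le (c := c) hVs hdiv hV1 hgr hR hC₀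
  obtain ⟨idiv, hdivb⟩ := integral_sq_div_truncation_le (c := c) hVs hdiv hV1 hgr hR hC₀
  obtain ⟨iDh, -⟩ := setIntegral_norm_sq_fderiv_le_truncation (c := c) hVs hdiv hV1 hR hC₀
  obtain ⟨iDψ, hDψ⟩ := hC₁ _ hh hhc
  obtain ⟨iD2ψ, hD2ψ⟩ := hC₂ _ hh hhc
  have hDh := hC₃ _ hh hhc
  have hZ0 : 0 ≤ Zb V c (4 * R) := Zb_nonneg V c (4 * R)
  refine ⟨iDψ, ?_, iDh, ?_, iD2ψ, ?_⟩
  · calc ∫ x, ‖fderiv ℝ (biotSavart fun y => ballCutoff c R y • V y) x‖ ^ 2 ≤ C₁ * ∫ y, ‖ballCutoff c R y • V y‖ ^ 2 := hDψ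
      _ ≤ C₁ * (4 * A_E * R) := mul_le_mul_of_nonneg_left hih hC₁0
      _ = 4 * C₁ * A_E * R := by ring
      _ ≤ max (4 * C₁) (max C₂ (C₃ * (2 + 8 * cc ^ 2 + 4))) * A_E * R :=
          mul_le_mul_of_nonneg_right (mul_le_mul_of_nonneg_right (le_max_left _ _) hAE) hR.le
  · have hsq : ∀ y, (VectorCalculus.divergence (fun y => ballCutoff c R y • V y) y) ^ 2 =
        ‖VectorCalculus.divergence (fun y => ballCutoff c R y • V y) y‖ ^ 2 := fun y => by
      rw [Real.norm_eq_abs, sq_abs]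
    have hdivb' : ∫ y, ‖VectorCalculus.divergence (fun y => ballCutoff c R y • V y) y‖ ^ 2 ≤ 4 * C₀ ^ 2 * A_E / R := by
      rw [show (fun y => ‖VectorCalculus.divergence (fun y => ballCutoff c R y • V y) y‖ ^ 2) =
        fun y => (VectorCalculus.divergence (fun y => ballCutoff c R y • V y) y) ^ 2 from funext fun y => (hsq y).symm]
      exact hdivb
    have hR1 : C₀ ^ 2 * A_E / R ≥ 0 := by positivity
    calc ∫ y, ‖fderiv ℝ (fun y => ballCutoff c R y • V y) y‖ ^ 2
        ≤ C₃ * ((∫ y, ‖curl (fun y => ballCutoff c R y • V y) y‖ ^ 2) +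
            ∫ y, (VectorCalculus.divergence (fun y => ballCutoff c R y • V y) y) ^ 2) := hDh
      _ ≤ C₃ * ((2 * Zb V c (4 * R) + 8 * cc ^ 2 * C₀ ^ 2 * A_E / R) + 4 * C₀ ^ 2 * A_E / R) := by gcongr
      _ = C₃ * 2 * Zb V c (4 * R) + C₃ * (8 * cc ^ 2 + 4) * (C₀ ^ 2 * A_E / R) := by ring
      _ ≤ C₃ * (2 + 8 * cc ^ 2 + 4) * Zb V c (4 * R) + C₃ * (2 + 8 * cc ^ 2 + 4) * (C₀ ^ 2 * A_E / R) := by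
          have h1 : C₃ * 2 ≤ C₃ * (2 + 8 * cc ^ 2 + 4) := by nlinarith [sq_nonneg cc]
          have h2 : C₃ * (8 * cc ^ 2 + 4) ≤ C₃ * (2 + 8 * cc ^ 2 + 4) := by nlinarith
          nlinarith [mul_le_mul_of_nonneg_right h1 hZ0, mul_le_mul_of_nonneg_right h2 hR1]
      _ = C₃ * (2 + 8 * cc ^ 2 + 4) * (Zb V c (4 * R) + C₀ ^ 2 * A_E / R) := by ring
      _ ≤ max (4 * C₁) (max C₂ (C₃ * (2 + 8 * cc ^ 2 + 4))) * (Zb V c (4 * R) + C₀ ^ 2 * A_E / R) :=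
          mul_le_mul_of_nonneg_right (le_trans (le_max_right _ _) (le_max_right _ _)) (by positivity)
  · calc ∫ x, ‖iteratedFDeriv ℝ 2 (biotSavart fun y => ballCutoff c R y • V y) x‖ ^ 2
        ≤ C₂ * ∫ y, ‖fderiv ℝ (fun y => ballCutoff c R y • V y) y‖ ^ 2 := hD2ψ
      _ ≤ max (4 * C₁) (max C₂ (C₃ * (2 + 8 * cc ^ 2 + 4))) * ∫ y, ‖fderiv ℝ (fun y => ballCutoff c R y • V y) y‖ ^ 2 :=
          mul_le_mul_of_nonneg_right (le_trans (le_max_left _ _) (le_max_right _ _))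
            (integral_nonneg fun y => by positivity)

end Summit.NavierStokesRegularity.NavierStokesRegularity.Theorems.NearExtremalTransiencePerFlow.TwoThirds

end
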